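import Summits.MatrixMultiplication.OmegaCensus.GoldenClassCheck

/-!
# ω-census, family (b3): conjecture C9 — the golden groups `𝔽_p[ζ₅] ⋊ C₅`: independence from a passed exact check

HONEST FRAMING (pub-omega census; verbatim): lottery ticket; floor = certified bounds/negative ranges.
Census BOOKKEEPING (conjecture C9 of the cell; pub-omega stpp-1 gen 22).  Vocabulary: `GoldenClassCheck.lean`.
* `ev_ne_zero` / `toGold_ne_zero` / `nondegZ_of_small`: a lattice element with a small nonzero coordinate is nonzero in `𝔽_p[ζ]`
  (`p ≥ 49`: `p ∤ c₀² − c₀c₁ − c₁² ∈ [−48, 48] ∖ {0}`); `NondegZ` = the numeric (decidable) form of nondegeneracy;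
* **`exists_indep_of_certOK`**: for an odd prime `p`, `τ² + τ = 1`, a pair `y ≡ τx`, a numerically nondegenerate box `(A, B, t)`
  and a 2-D pattern with integer trims passing the exact check `CertOK`, the box `gbox (x/8) (y/8) A B t` is nondegenerate and its
  arc set (`QuadArcs.blockArcSet`) is an independent pattern — coordinates of the products `ζ^s α`, `ζ^s β` are `(C₀x + C₁y)/8`
  (`act_gz_toGold`), phases `8·val = a p + e` (`EisArcs.eight_val_div`), residues `a ≡ C₀γ₀ + C₁γ₁ (mod 8)`
  (`EisArcs.phase_residue`, `map_lin`), and `QuadArcs.patIndep_blockCells`.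
The counts, the class-check bridge and the numeric envelopes are in `GoldenCounts.lean`.  Nothing here is progress on `ω`.
-/

namespace Summit.MatrixMultiplication.OmegaCensus

open Finset

namespace GoldArcs

open EisArcs (PhiR eight_val_div phase_residue bLen eight_mul_bLen_ge)
open QuadArcs (blockCells blockArcSet patIndep_blockCells blockArcSet_subset card_blockArcSet)

variable {p : ℕ} {τ : ZMod p}

/-! ### Nondegeneracy -/

/-- `c₀² − c₀c₁ − c₁²` is nonzero and at most `48` in absolute value on small nonzero pairs. [folklore] -/
theorem norm_small : ∀ i j : Fin 9, ((i : ℤ) - 4, (j : ℤ) - 4) ≠ (0, 0) →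
    ((i : ℤ) - 4) ^ 2 - ((i : ℤ) - 4) * ((j : ℤ) - 4) - ((j : ℤ) - 4) ^ 2 ≠ 0 ∧
    |((i : ℤ) - 4) ^ 2 - ((i : ℤ) - 4) * ((j : ℤ) - 4) - ((j : ℤ) - 4) ^ 2| ≤ 48 := by
  decide

/-- The value `c₀X + c₁Y` of a small nonzero pair is nonzero (`p ≥ 49` prime, `X ≠ 0`, `τX = Y`, `τ² + τ = 1`). [folklore] -/
theorem ev_ne_zero [Fact p.Prime] (hp : 49 ≤ p) (hτ : τ ^ 2 + τ = 1) {X Y : ZMod p} (hX : X ≠ 0) (h : τ * X = Y)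
    {v : ℤ × ℤ} (hv : ClassDataG.Small v) : ev X Y v ≠ 0 := by
  obtain ⟨hv0, h1, h2⟩ := hv
  intro he
  have he' : ((v.1 : ZMod p) + (v.2 : ZMod p) * τ) * X = 0 := by
    have : ev X Y v = (v.1 : ZMod p) * X + (v.2 : ZMod p) * Y := rfl
    rw [this, ← h] at he
    linear_combination he
  have hk : (v.1 : ZMod p) + (v.2 : ZMod p) * τ = 0 := by
    rcases mul_eq_zero.1 he' with h0 | h0
    · exact h0
    · exact absurd h0 hX
  have hN : (((v.1 ^ 2 - v.1 * v.2 - v.2 ^ 2 : ℤ)) : ZMod p) = 0 := by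
    push_cast
    linear_combination ((v.1 : ZMod p) - v.2 - v.2 * τ) * hk + ((v.2 : ZMod p)) ^ 2 * hτ
  rw [ZMod.intCast_zmod_eq_zero_iff_dvd] at hN
  rw [abs_le] at h1 h2
  obtain ⟨i, hi⟩ : ∃ i : Fin 9, (i : ℤ) - 4 = v.1 := ⟨⟨(v.1 + 4).toNat, by omega⟩, by dsimp only; omega⟩
  obtain ⟨j, hj⟩ : ∃ j : Fin 9, (j : ℤ) - 4 = v.2 := ⟨⟨(v.2 + 4).toNat, by omega⟩, by dsimp only; omega⟩
  have hne : ((i : ℤ) - 4, (j : ℤ) - 4) ≠ (0, 0) := by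
    rw [hi, hj]; intro h0; exact hv0 (Prod.ext (congrArg Prod.fst h0) (congrArg Prod.snd h0))
  obtain ⟨hN0, hN48⟩ := norm_small i j hne
  rw [hi, hj] at hN0 hN48
  have hle := Int.le_of_dvd (abs_pos.2 hN0) ((dvd_abs _ _).2 hN)
  have : (49 : ℤ) ≤ p := by exact_mod_cast hp
  omega

/-- A lattice element with a small nonzero coordinate is nonzero in `𝔽_p[ζ]`. [folklore] -/
theorem toGold_ne_zero [Fact p.Prime] (hp : 49 ≤ p) (hτ : τ ^ 2 + τ = 1) {X Y : ZMod p} (hX : X ≠ 0) (h : τ * X = Y)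
    {V : (ℤ × ℤ) × (ℤ × ℤ)} (hV : ClassDataG.Small V.1 ∨ ClassDataG.Small V.2) : (toGold X Y V : Gold p τ) ≠ 0 := by
  intro h0
  rcases hV with hV | hV
  · exact ev_ne_zero hp hτ hX h hV (congrArg QuadraticAlgebra.re h0)
  · exact ev_ne_zero hp hτ hX h hV (congrArg QuadraticAlgebra.im h0)

/-- Numeric nondegeneracy of a lattice element at the Thue pair `(x, y)`: one of `8·re`, `8·im` (`= C₀x + C₁y`) is nonzero
mod `p` (decidable for numerals). [folklore] -/
def NondegZ (p : ℕ) (x y : ℤ) (V : (ℤ × ℤ) × (ℤ × ℤ)) : Prop :=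
  ((evZ x y V.1 : ℤ) : ZMod p) ≠ 0 ∨ ((evZ x y V.2 : ℤ) : ZMod p) ≠ 0

/-- `NondegZ` is decidable. [folklore] -/
instance (p : ℕ) (x y : ℤ) (V : (ℤ × ℤ) × (ℤ × ℤ)) : Decidable (NondegZ p x y V) := by unfold NondegZ; infer_instance

/-- A lattice element with a small nonzero coordinate is numerically nondegenerate (`p ≥ 49`, `x ≢ 0`, `y ≡ τx`). [folklore] -/
theorem nondegZ_of_small [Fact p.Prime] (hp : 49 ≤ p) (hτ : τ ^ 2 + τ = 1) {x y : ℤ} (hx : (x : ZMod p) ≠ 0)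
    (hyx : (y : ZMod p) = τ * x) {V : (ℤ × ℤ) × (ℤ × ℤ)} (hV : ClassDataG.Small V.1 ∨ ClassDataG.Small V.2) :
    NondegZ p x y V := by
  have hev : ∀ v : ℤ × ℤ, ((evZ x y v : ℤ) : ZMod p) = ev (x : ZMod p) (y : ZMod p) v := by
    intro v; simp only [evZ, ev, AddMonoidHom.coe_mk, ZeroHom.coe_mk]; push_cast; ring
  rcases hV with hV | hV
  · exact Or.inl (by rw [hev]; exact ev_ne_zero hp hτ hx hyx.symm hV)
  · exact Or.inr (by rw [hev]; exact ev_ne_zero hp hτ hx hyx.symm hV)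

/-! ### Independence from the exact check -/

/-- `PairOK` only depends on `Φ mod 8`. [folklore] -/
theorem pairOK_of_emod {Φ Φv E φ φ' lo hi lo' hi' : ℤ} (hΦ : Φ % 8 = Φv)
    (h : PhaseArcs.PairOK p Φv E φ φ' lo hi lo' hi') : PhaseArcs.PairOK p Φ E φ φ' lo hi lo' hi' := by
  obtain ⟨hE, h0, hplus, hminus⟩ := h
  have hq : Φ % 8 + 8 * (Φ / 8) = Φ := Int.emod_add_mul_ediv Φ 8
  refine ⟨hE, ?_, ?_, ?_⟩
  · intro h'; apply h0; omega
  · intro h'; exact hplus (by omega)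
  · intro h'; exact hminus (by omega)

/-- **Independence (golden family).** See the module docstring. [folklore] -/
theorem exists_indep_of_certOK [Fact p.Prime] (hp : 3 ≤ p) (hτ : τ ^ 2 + τ = 1) (x y : ℤ)
    (hyx : (y : ZMod p) = τ * x) (A B : (ℤ × ℤ) × (ℤ × ℤ)) (t : ZMod 5)
    (hA : NondegZ p x y A) (hB : NondegZ p x y B) (ht : t ≠ 0)
    (P : Fin 3 × Fin 3 → Finset (ℤ × ℤ)) (lo₁ hi₁ lo₂ hi₂ : Fin 3 × Fin 3 → ℤ × ℤ → ℕ)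
    (hP : ∀ c, ∀ φ ∈ P c, (0 ≤ φ.1 ∧ φ.1 < 8) ∧ (0 ≤ φ.2 ∧ φ.2 < 8))
    (hok : CertOK p x y A B t P lo₁ hi₁ lo₂ hi₂) :
    haveI : NeZero p := ⟨(Fact.out : p.Prime).ne_zero⟩
    ∃ D : RCyc.RBox (Gold p τ) 5, D.Nondeg Gold.gz ∧ D.PatIndep Gold.gz
      (blockArcSet p (-1) τ P (fun c φ => (lo₁ c φ : ℤ)) (fun c φ => (hi₁ c φ : ℤ)) (fun c φ => (lo₂ c φ : ℤ))
        (fun c φ => (hi₂ c φ : ℤ))) := by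
  have hprime : p.Prime := Fact.out
  haveI : NeZero p := ⟨hprime.ne_zero⟩
  have hpodd : Odd (p : ℤ) := by
    have h2 : ¬ 2 ∣ p := fun h => by
      have := hprime.eq_one_or_self_of_dvd 2 h
      omega
    rcases Nat.even_or_odd p with h | h
    · exact absurd h.two_dvd h2
    · exact_mod_cast h
  have h8 : (8 : ZMod p) ≠ 0 := by
    intro h
    have h' : ((8 : ℕ) : ZMod p) = 0 := by exact_mod_cast h
    rw [ZMod.natCast_eq_zero_iff] at h'
    have h2 : p ∣ 2 := hprime.dvd_of_dvd_pow (show p ∣ 2 ^ 3 by simpa using h')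
    have := Nat.le_of_dvd two_pos h2
    omega
  -- `X = x/8`, `Y = y/8`
  set ι : ZMod p := (8 : ZMod p)⁻¹ with hι
  set X : ZMod p := (x : ZMod p) * ι with hXdef
  set Y : ZMod p := (y : ZMod p) * ι with hYdef
  have hτX : τ * X = Y := by rw [hXdef, hYdef, hyx]; ring
  have hι0 : ι ≠ 0 := inv_ne_zero h8
  -- values are `evZ/8`
  have hev : ∀ C : ℤ × ℤ, ev X Y C = ((evZ x y C : ℤ) : ZMod p) * ι := by
    intro C
    simp only [ev, evZ, AddMonoidHom.coe_mk, ZeroHom.coe_mk, hXdef, hYdef]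
    push_cast
    ring
  -- the box
  set D : RCyc.RBox (Gold p τ) 5 := gbox X Y A B t with hD
  -- coordinates of the products
  have hprod : ∀ (V : (ℤ × ℤ) × (ℤ × ℤ)) (s : ZMod 5), RCyc.act Gold.gz s * (toGold X Y V : Gold p τ) =
      ⟨((evZ x y (gR V s) : ℤ) : ZMod p) * ι, ((evZ x y (gI V s) : ℤ) : ZMod p) * ι⟩ := by
    intro V s
    rw [act_gz_toGold hτ hτX, toGold, hev, hev]
    rfl
  -- phases
  choose aR haR using fun (V : (ℤ × ℤ) × (ℤ × ℤ)) (s : ZMod 5) => eight_val_div h8 (evZ x y (gR V s))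
  choose aI haI using fun (V : (ℤ × ℤ) × (ℤ × ℤ)) (s : ZMod 5) => eight_val_div h8 (evZ x y (gI V s))
  have hαR : ∀ s i, 8 * ((RCyc.act Gold.gz s * D.α i).re.val : ℤ) = col (aR A) s i * p + col (fun s => evZ x y (gR A s)) s i := by
    intro s i
    fin_cases i
    · simp [hD, gbox, col]
    · simpa [hD, gbox, col, hprod A s] using haR A s
    · simp [hD, gbox, col]
  have hαI : ∀ s i, 8 * ((RCyc.act Gold.gz s * D.α i).im.val : ℤ) = col (aI A) s i * p + col (fun s => evZ x y (gI A s)) s i := by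
    intro s i
    fin_cases i
    · simp [hD, gbox, col]
    · simpa [hD, gbox, col, hprod A s] using haI A s
    · simp [hD, gbox, col]
  have hβR : ∀ s j, 8 * ((RCyc.act Gold.gz s * D.β j).re.val : ℤ) = col (aR B) s j * p + col (fun s => evZ x y (gR B s)) s j := by
    intro s j
    fin_cases j
    · simp [hD, gbox, col]
    · simpa [hD, gbox, col, hprod B s] using haR B s
    · simp [hD, gbox, col]
  have hβI : ∀ s j, 8 * ((RCyc.act Gold.gz s * D.β j).im.val : ℤ) = col (aI B) s j * p + col (fun s => evZ x y (gI B s)) s j := by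
    intro s j
    fin_cases j
    · simp [hD, gbox, col]
    · simpa [hD, gbox, col, hprod B s] using haI B s
    · simp [hD, gbox, col]
  -- `PhiR` of the box is `lin`
  have hPhi : ∀ (a b : ZMod 5 → ℤ) (c c' : Fin 3 × Fin 3), PhiR D (col a) (col b) c c' = lin t a b c c' := by
    intro a b c c'; rfl
  -- residues of the phases: `a ≡ C₀γ₀ + C₁γ₁`
  set γ₀ : ZMod 8 := -((p : ZMod 8) * x) with hγ₀
  set γ₁ : ZMod 8 := -((p : ZMod 8) * y) with hγ₁
  have hres : ∀ {a : ℤ} {C : ℤ × ℤ} {v : ℕ}, 8 * (v : ℤ) = a * p + evZ x y C → ((a : ℤ) : ZMod 8) = ev8 γ₀ γ₁ C := by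
    intro a C v h
    rw [phase_residue hpodd h]
    simp only [evZ, ev8, AddMonoidHom.coe_mk, ZeroHom.coe_mk, hγ₀, hγ₁]
    push_cast
    ring
  have resR : ∀ V s, ((aR V s : ℤ) : ZMod 8) = ev8 γ₀ γ₁ (gR V s) := fun V s => hres (haR V s)
  have resI : ∀ V s, ((aI V s : ℤ) : ZMod 8) = ev8 γ₀ γ₁ (gI V s) := fun V s => hres (haI V s)
  -- `Φ ≡ ev8 (coef) (mod 8)` and `E = evZ (coef)`
  have hmodR : ∀ c c', ((lin t (aR A) (aR B) c c' : ℤ) : ZMod 8) = ev8 γ₀ γ₁ (coefR A B t c c') := by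
    intro c c'
    have h1 := map_lin (Int.castAddHom (ZMod 8)) t (aR A) (aR B) c c'
    have h2 := map_lin (ev8 γ₀ γ₁) t (gR A) (gR B) c c'
    simp only [Int.coe_castAddHom] at h1
    rw [h1, coefR, h2]
    congr 1 <;> funext s <;> simp only [Function.comp_apply, resR]
  have hmodI : ∀ c c', ((lin t (aI A) (aI B) c c' : ℤ) : ZMod 8) = ev8 γ₀ γ₁ (coefI A B t c c') := by
    intro c c'
    have h1 := map_lin (Int.castAddHom (ZMod 8)) t (aI A) (aI B) c c'
    have h2 := map_lin (ev8 γ₀ γ₁) t (gI A) (gI B) c c'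
    simp only [Int.coe_castAddHom] at h1
    rw [h1, coefI, h2]
    congr 1 <;> funext s <;> simp only [Function.comp_apply, resI]
  have herrR : ∀ c c', lin t (fun s => evZ x y (gR A s)) (fun s => evZ x y (gR B s)) c c' = evZ x y (coefR A B t c c') := by
    intro c c'
    rw [coefR, map_lin]
    rfl
  have herrI : ∀ c c', lin t (fun s => evZ x y (gI A s)) (fun s => evZ x y (gI B s)) c c' = evZ x y (coefI A B t c c') := by
    intro c c'
    rw [coefI, map_lin]
    rfl
  have hΦmod : ∀ {Φ : ℤ} {Φv : ZMod 8}, ((Φ : ℤ) : ZMod 8) = Φv → Φ % 8 = (Φv.val : ℤ) := by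
    intro Φ Φv h
    rw [← h, ZMod.val_intCast]
    rfl
  -- trims as integer functions
  set Lo₁ : Fin 3 × Fin 3 → ℤ × ℤ → ℤ := fun c φ => (lo₁ c φ : ℤ) with hLo₁
  set Hi₁ : Fin 3 × Fin 3 → ℤ × ℤ → ℤ := fun c φ => (hi₁ c φ : ℤ) with hHi₁
  set Lo₂ : Fin 3 × Fin 3 → ℤ × ℤ → ℤ := fun c φ => (lo₂ c φ : ℤ) with hLo₂
  set Hi₂ : Fin 3 × Fin 3 → ℤ × ℤ → ℤ := fun c φ => (hi₂ c φ : ℤ) with hHi₂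
  have hl₁ : ∀ c, ∀ φ ∈ P c, 0 ≤ Lo₁ c φ := fun c φ _ => Nat.cast_nonneg _
  have hh₁ : ∀ c, ∀ φ ∈ P c, 0 ≤ Hi₁ c φ := fun c φ _ => Nat.cast_nonneg _
  have hl₂ : ∀ c, ∀ φ ∈ P c, 0 ≤ Lo₂ c φ := fun c φ _ => Nat.cast_nonneg _
  have hh₂ : ∀ c, ∀ φ ∈ P c, 0 ≤ Hi₂ c φ := fun c φ _ => Nat.cast_nonneg _
  -- the pair condition
  have hcond : ∀ c c', c ≠ c' → ∀ φ ∈ P c, ∀ φ' ∈ P c',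
      PhaseArcs.PairOK p (PhiR D (col (aR A)) (col (aR B)) c c')
          (PhiR D (col fun s => evZ x y (gR A s)) (col fun s => evZ x y (gR B s)) c c') φ.1 φ'.1
          (Lo₁ c φ) (Hi₁ c φ) (Lo₁ c' φ') (Hi₁ c' φ') ∨
        PhaseArcs.PairOK p (PhiR D (col (aI A)) (col (aI B)) c c')
          (PhiR D (col fun s => evZ x y (gI A s)) (col fun s => evZ x y (gI B s)) c c') φ.2 φ'.2
          (Lo₂ c φ) (Hi₂ c φ) (Lo₂ c' φ') (Hi₂ c' φ') := by
    intro c c' hcc φ hφ φ' hφ'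
    rw [hPhi, hPhi, hPhi, hPhi, herrR, herrI]
    rcases hok c c' hcc φ hφ φ' hφ' with h | h
    · exact Or.inl (pairOK_of_emod (hΦmod (hmodR c c')) h)
    · exact Or.inr (pairOK_of_emod (hΦmod (hmodI c c')) h)
  -- independence
  have indep : D.PatIndep Gold.gz (blockArcSet p (-1) τ P Lo₁ Hi₁ Lo₂ Hi₂) :=
    (patIndep_blockCells D Gold.gz (col (aR A)) (col fun s => evZ x y (gR A s)) (col (aR B))
      (col fun s => evZ x y (gR B s)) (col (aI A)) (col fun s => evZ x y (gI A s)) (col (aI B))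
      (col fun s => evZ x y (gI B s)) hαR hβR hαI hβI P Lo₁ Hi₁ Lo₂ Hi₂ hl₁ hh₁ hl₂ hh₂ hcond).anti
      (blockArcSet_subset hP hl₁ hh₁ hl₂ hh₂)
  -- nondegeneracy
  have hnd : ∀ {V : (ℤ × ℤ) × (ℤ × ℤ)}, NondegZ p x y V → (toGold X Y V : Gold p τ) ≠ 0 := by
    intro V hV h0
    have h1 := congrArg QuadraticAlgebra.re h0
    have h2 := congrArg QuadraticAlgebra.im h0
    simp only [toGold, hev, QuadraticAlgebra.re_zero, QuadraticAlgebra.im_zero, mul_eq_zero, hι0, or_false] at h1 h2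
    rcases hV with h | h
    · exact h h1
    · exact h h2
  have hα0 : (toGold X Y A : Gold p τ) ≠ 0 := hnd hA
  have hβ0 : (toGold X Y B : Gold p τ) ≠ 0 := hnd hB
  have hD' : D.Nondeg Gold.gz := by
    refine D.nondeg_of Gold.gz ?_ ?_
    · intro i i' h
      simp only [hD, gbox, Prod.mk.injEq] at h
      obtain ⟨h1, h2⟩ := h
      fin_cases i <;> fin_cases i' <;> simp (decide := true) [hα0, hα0.symm] at h1 h2 ⊢
    · intro j j' h
      simp only [hD, gbox, Prod.mk.injEq] at h
      obtain ⟨h1, h2⟩ := h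
      fin_cases j <;> fin_cases j' <;> simp (decide := true) [hβ0, hβ0.symm, ht, ht.symm] at h1 h2 ⊢
  exact ⟨D, hD', indep⟩

end GoldArcs

end Summit.MatrixMultiplication.OmegaCensus
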